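import Summits.QuantumFields.YangMills.Theorems.FluctuationComparisonRegPrIntLS2BetaSourceBudgetCore
import Mathlib.Analysis.Complex.Exponential
import HarnessLib

/-!
# S2β · (SCT″-c)₁, S-KER LETTER 4 — «RESCALING ROWS WITH MULTIPLICATIVE FACTORS»: rows `ρ_{i+1} ≤ (1+ε_i)·|I|⁻¹Σ_a ρ_i(x_a) + src_{i+1}` (the (β-3)′ shape: the
# oscillation term is MULTIPLICATIVE, ARCHITECT RULING px17 g22 2026-08-31T19:55Z) become the engine's coefficient-ONE rows for `ρ̂_i := ρ_i ∕ Π_{j<i}(1+ε_j)` with the SAME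
# sources, and `ρ_n² ≤ exp(2·Σ_{j<m} ε_j)·ρ̂_n²` — so ✓`weighted_readMax_sq_le_sources(_T3)` applies to `ρ̂` and the budget inherits the factor `exp(2Σε)` (the `e^{c_cΣθ}` slot)

Cell `ym3-torus` (YM ladder rung R3 = continuum `SU(2)` Yang–Mills on the three-torus at fixed lattice data — a RUNG: NOT d = 4, NOT infinite volume, NOT a mass gap,
NOT Clay).  Width seat «width 16» `ym3-torus-px16` (gen 23), S2β pairing-letter lane holder; crux `stmt-QuantumFields-20520`, LINE g18-1 S2β.
`--kind proof --supports stmt-QuantumFields-20520 --as helper`, count-neutral, DEFINITION-FREE (0 `def`, 0 `instance`, 0 `notation`, 0 `sorry`, default heartbeats).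

WHAT IS PROVED (sorry-free; generic `P : Params`, any orientation, abstract `ε ≥ 0`).
§1 ★`one_le_prod_one_add`, ★`prod_one_add_mono` — `1 ≤ Π_{j<i}(1+ε_j) ≤ Π_{j<m}(1+ε_j)` for `i ≤ m` (and `≤ exp(Σ_{j<m} ε_j)` by Mathlib ✓`Real.prod_one_add_le_exp_sum`).
§2 ★★★`rows_rescale` — from the multiplicative rows (`i < m`) to coefficient-one rows for `ρ̂ i y := ρ i y ∕ Π_{j<i}(1+ε_j)` with sources `src` (unchanged: `src∕Π ≤ src`).
§3 ★★`sq_le_exp_mul_rescaled_sq` — `ρ n y² ≤ exp(2·Σ_{j<m} ε_j)·ρ̂ n y²` for `n ≤ m`; ★`rescaled_nonneg`.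

HONEST SCOPE.  Elementary real bookkeeping; nothing of Bałaban's analysis is asserted or proved ([Balaban1985Averaging] (19)–(20) p.21, Prop. 4 (128)–(135) pp.37–38; [Balaban1987RG1]
(0.11) p.253); rows v2, (BKG), OSC, (RSP), NC-ROW′, (ST‴), LOC‴, h3 HYPOTHESES elsewhere; GAP♯∘ (`stub_uniformFibreGapOrbit`, registry untouched, 0∕5), S2β, crux 20520, 19936, 19200
and `YM3TorusSU2` are NOT proved; no registered stub is closed; rung R3 = SU(2) YM₃ on T³ — NOT d = 4, NOT infinite volume, NOT a mass gap, NOT Clay; the Yang–Mills mass gap is NOT proved.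
-/

set_option autoImplicit false

noncomputable section

open Finset

namespace Summit.QuantumFields.YangMills.Theorems.FluctuationComparisonRegPrIntLS2BetaRowsRescale

open Literature.MathematicalPhysics.QuantumFieldTheory.Balaban1983to89
open Literature.MathematicalPhysics.QuantumFieldTheory.Balaban1983to89.T4Continuum
open Literature.MathematicalPhysics.QuantumFieldTheory.Balaban1983to89.BlockAveraging (Idx)
open Literature.MathematicalPhysics.QuantumFieldTheory.Balaban1983to89.B10Eq47AxialChi (shiftN)

variable {P : Params}

/-! ## §1 The product of the factors -/

/-- ★ `1 ≤ Π_{j<i} (1 + ε_j)` for `ε ≥ 0`. [folklore] -/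
theorem one_le_prod_one_add (ε : ℕ → ℝ) (hε : ∀ j, 0 ≤ ε j) (i : ℕ) : 1 ≤ ∏ j ∈ Finset.range i, (1 + ε j) := by
  induction i with
  | zero => simp
  | succ i ih =>
      rw [Finset.prod_range_succ]
      have h1 : (1 : ℝ) ≤ 1 + ε i := by linarith [hε i]
      nlinarith [ih, h1]

/-- ★ `Π_{j<i} (1 + ε_j) ≤ Π_{j<m} (1 + ε_j)` for `i ≤ m`, `ε ≥ 0`. [folklore] -/
theorem prod_one_add_mono (ε : ℕ → ℝ) (hε : ∀ j, 0 ≤ ε j) {i m : ℕ} (him : i ≤ m) :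
    ∏ j ∈ Finset.range i, (1 + ε j) ≤ ∏ j ∈ Finset.range m, (1 + ε j) := by
  rw [← Finset.prod_range_mul_prod_Ico _ him]
  have h1 : 1 ≤ ∏ j ∈ Finset.Ico i m, (1 + ε j) := by
    induction m, him using Nat.le_induction with
    | base => simp
    | succ m hm ih =>
        rw [Finset.prod_Ico_succ_top hm]
        have : (1 : ℝ) ≤ 1 + ε m := by linarith [hε m]
        nlinarith
  have h0 : 0 ≤ ∏ j ∈ Finset.range i, (1 + ε j) := zero_le_one.trans (one_le_prod_one_add ε hε i)
  exact le_mul_of_one_le_right h0 h1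

/-! ## §2 Rescaling the rows -/

/-- ★ The rescaled family is nonnegative. [folklore] -/
theorem rescaled_nonneg (ρ : (i : ℕ) → Site P i → ℝ) (hρ : ∀ i x, 0 ≤ ρ i x) (ε : ℕ → ℝ) (hε : ∀ j, 0 ≤ ε j) (i : ℕ) (x : Site P i) :
    0 ≤ ρ i x / ∏ j ∈ Finset.range i, (1 + ε j) :=
  div_nonneg (hρ i x) (zero_le_one.trans (one_le_prod_one_add ε hε i))

/-- ★★★ **RESCALING**: if `ρ_{i+1}(y) ≤ (1+ε_i)·|I|⁻¹·Σ_a ρ_i(x_a(y)) + src_{i+1}(y)` for `i < m` (`ε, src ≥ 0`), then `ρ̂_i := ρ_i ∕ Π_{j<i}(1+ε_j)` obeys the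
coefficient-ONE rows `ρ̂_{i+1}(y) ≤ |I|⁻¹·Σ_a ρ̂_i(x_a(y)) + src_{i+1}(y)` (the sources only shrink). [cite: Balaban1985Averaging, (19)-(20) p.21; Balaban1987RG1, (0.11) p.253] -/
theorem rows_rescale {μ ν : Fin P.d} (m : ℕ) (ρ src : (i : ℕ) → Site P i → ℝ) (hsrc : ∀ i x, 0 ≤ src i x)
    (ε : ℕ → ℝ) (hε : ∀ j, 0 ≤ ε j)
    (hrow : ∀ i, i < m → ∀ y' : Site P (i + 1),
        ρ (i + 1) y' ≤ (1 + ε i) * ((Fintype.card (Idx P) : ℝ)⁻¹ *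
            ∑ a ∈ (Finset.univ : Finset (Idx P)) ×ˢ (Finset.range P.L ×ˢ Finset.range P.L), ρ i (shiftN (shiftN (Site.blockSite y' a.1.1) μ a.2.1) ν a.2.2)) +
          src (i + 1) y') :
    ∀ i, i < m → ∀ y' : Site P (i + 1),
        ρ (i + 1) y' / ∏ j ∈ Finset.range (i + 1), (1 + ε j) ≤ (Fintype.card (Idx P) : ℝ)⁻¹ *
            ∑ a ∈ (Finset.univ : Finset (Idx P)) ×ˢ (Finset.range P.L ×ˢ Finset.range P.L),
              ρ i (shiftN (shiftN (Site.blockSite y' a.1.1) μ a.2.1) ν a.2.2) / ∏ j ∈ Finset.range i, (1 + ε j) +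
          src (i + 1) y' := by
  intro i hi y'
  set D : ℝ := ∏ j ∈ Finset.range i, (1 + ε j) with hD
  set S : ℝ := (Fintype.card (Idx P) : ℝ)⁻¹ *
      ∑ a ∈ (Finset.univ : Finset (Idx P)) ×ˢ (Finset.range P.L ×ˢ Finset.range P.L), ρ i (shiftN (shiftN (Site.blockSite y' a.1.1) μ a.2.1) ν a.2.2) with hS
  have hD1 : 1 ≤ D := one_le_prod_one_add ε hε i
  have hD0 : 0 < D := lt_of_lt_of_le zero_lt_one hD1
  have hε1 : 1 ≤ 1 + ε i := by linarith [hε i]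
  have hε0 : 0 < 1 + ε i := lt_of_lt_of_le zero_lt_one hε1
  have hDsucc : ∏ j ∈ Finset.range (i + 1), (1 + ε j) = D * (1 + ε i) := by rw [Finset.prod_range_succ]
  -- the average of the rescaled family is `S ∕ D`
  have havg : (Fintype.card (Idx P) : ℝ)⁻¹ *
      ∑ a ∈ (Finset.univ : Finset (Idx P)) ×ˢ (Finset.range P.L ×ˢ Finset.range P.L),
        ρ i (shiftN (shiftN (Site.blockSite y' a.1.1) μ a.2.1) ν a.2.2) / D = S / D := by
    rw [hS, ← Finset.sum_div, mul_div_assoc]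
  rw [hDsucc, havg]
  have h := hrow i hi y'
  have hs := hsrc (i + 1) y'
  -- `ρ_{i+1} ≤ (1+ε) S + src` ⇒ `ρ_{i+1} ∕ (D(1+ε)) ≤ S∕D + src∕(D(1+ε)) ≤ S∕D + src`
  have hDε : 0 < D * (1 + ε i) := mul_pos hD0 hε0
  have hDε1 : 1 ≤ D * (1 + ε i) := one_le_mul_of_one_le_of_one_le hD1 hε1
  rw [div_le_iff₀ hDε]
  have hsrc' : src (i + 1) y' ≤ src (i + 1) y' * (D * (1 + ε i)) := le_mul_of_one_le_right hs hDε1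
  have hSD : (S / D + src (i + 1) y') * (D * (1 + ε i)) = (1 + ε i) * S + src (i + 1) y' * (D * (1 + ε i)) := by
    field_simp
  rw [hSD]
  linarith

/-! ## §3 Back to `ρ` -/

/-- ★★ **UNSCALING THE SQUARES**: `ρ n y² ≤ exp(2·Σ_{j<m} ε_j)·(ρ n y ∕ Π_{j<n}(1+ε_j))²` for `n ≤ m` (`ε ≥ 0`). [folklore] -/
theorem sq_le_exp_mul_rescaled_sq (ρ : (i : ℕ) → Site P i → ℝ) (ε : ℕ → ℝ) (hε : ∀ j, 0 ≤ ε j)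
    {n m : ℕ} (hnm : n ≤ m) (y : Site P n) :
    ρ n y ^ 2 ≤ Real.exp (2 * ∑ j ∈ Finset.range m, ε j) * (ρ n y / ∏ j ∈ Finset.range n, (1 + ε j)) ^ 2 := by
  set D : ℝ := ∏ j ∈ Finset.range n, (1 + ε j) with hD
  have hD1 : 1 ≤ D := one_le_prod_one_add ε hε n
  have hD0 : 0 < D := lt_of_lt_of_le zero_lt_one hD1
  have hDexp : D ≤ Real.exp (∑ j ∈ Finset.range m, ε j) :=
    (prod_one_add_mono ε hε hnm).trans (Real.prod_one_add_le_exp_sum _ hε)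
  have hexp2 : Real.exp (2 * ∑ j ∈ Finset.range m, ε j) = Real.exp (∑ j ∈ Finset.range m, ε j) ^ 2 := by
    rw [← Real.exp_nat_mul]; norm_num
  rw [hexp2, div_pow, ← mul_div_assoc, le_div_iff₀ (pow_pos hD0 2)]
  have h1 : D ^ 2 ≤ Real.exp (∑ j ∈ Finset.range m, ε j) ^ 2 := pow_le_pow_left₀ hD0.le hDexp 2
  have h2 : 0 ≤ ρ n y ^ 2 := sq_nonneg _
  calc ρ n y ^ 2 * D ^ 2 ≤ ρ n y ^ 2 * Real.exp (∑ j ∈ Finset.range m, ε j) ^ 2 := mul_le_mul_of_nonneg_left h1 h2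
    _ = Real.exp (∑ j ∈ Finset.range m, ε j) ^ 2 * ρ n y ^ 2 := mul_comm _ _

end Summit.QuantumFields.YangMills.Theorems.FluctuationComparisonRegPrIntLS2BetaRowsRescale

end
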